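import Mathlib
import Literature.NumberTheory.Transcendental.ZagierDilogarithmConjecture
import Literature.NumberTheory.Transcendental.BlochWignerDilogarithm
import Literature.NumberTheory.Transcendental.BlochWignerDilogarithmProofs
import Summits.KontsevichZagierPeriods.KontsevichZagierPeriods.Theorems.HyperbolicBlochZagierDilogarithmConjectureStubAllRootsOfUnityIff
import Summits.KontsevichZagierPeriods.KontsevichZagierPeriods.Theorems.HyperbolicBlochZagierDilogarithmConjectureStubCyclotomicSectorTorsionIff
import Summits.KontsevichZagierPeriods.KontsevichZagierPeriods.Theorems.HyperbolicBlochZagierDilogarithmConjectureStubCyclotomicFolding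
import Summits.KontsevichZagierPeriods.KontsevichZagierPeriods.Theorems.HyperbolicBlochZagierDilogarithmConjectureStubCyclotomicSpanning
import HarnessLib

/-!
# `ZagierDilogarithmConjecture` (stmt-KontsevichZagierPeriods-10550) — line `kummer-clausen-linearisation`
(reshape c5, "the cyclotomic tower and the abelian sector"), stub `stub_allRootsOfUnity_iff_milnor`

**The torsion-form sector of Zagier's conjecture for ALL roots of unity is EXACTLY the conjunction of
Milnor's conjectures over all levels — unconditionally.** Write `D` for the Bloch–Wigner dilogarithm
(`blochWignerDilog`), `⟨dilogRelators⟩ ⊆ ℤ[ℂ]` for the relator group of Zagier's dilogarithm conjecture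
(Neumann 1998, §2.1) and `ζ_N = e^{2πi/N}`. Consider

* the *all-roots-of-unity sector* (torsion form): for every finite family `(uᵢ)` of roots of unity of
  the open upper half plane (each `uᵢ` of SOME order `Nᵢ ≥ 1`) and integers `nᵢ` with
  `Σᵢ nᵢ D(uᵢ) = 0`, some positive multiple `M • Σᵢ nᵢ [uᵢ]` lies in `⟨dilogRelators⟩`;
* `Milnor_N` (Milnor 1982, Appendix): the primitive Clausen values `D(ζ_N^c)`, `c ∈ (ℤ/N)ˣ`,
  `0 < c < N/2`, admit only the trivial `ℤ`-relation.

**Theorem.** The all-roots-of-unity sector holds if and only if `Milnor_N` holds for every `N ≥ 1`.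

Proof: a pure composition of landed theorems of this line. `stub_cyclotomicSpanning` (weight-2 Kubert
spanning of `ℤ[μ_N]` by the unit classes modulo the relators, unconditional) feeds
`stub_cyclotomicFolding` (folding every cyclotomic combination onto the units of the open upper half),
which is the hypothesis of `stub_cyclotomicSectorTorsion_iff` (level-wise: `Sector_N ↔ Milnor_N` for every
`N`); finally `stub_allRootsOfUnity_iff` assembles the levels (restriction to level `N` for `⇒`, passage
to the common level `∏ᵢ Nᵢ` for `⇐`).
Sorry-free; axioms ⊆ {propext, Classical.choice, Quot.sound}.

## References

* W. D. Neumann, *Hilbert's 3rd problem and invariants of 3-manifolds*, Geom. Topol. Monogr. 1 (1998),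
  §2.1. [Neumann1998]
* J. Milnor, *Hyperbolic geometry: the first 150 years*, Bull. AMS 6 (1982), Appendix (the conjecture
  on the values `Л(πc/N)`). [Milnor1982]
-/

noncomputable section

open scoped BigOperators ComplexConjugate
open Literature.NumberTheory.Transcendental

namespace Summit.KontsevichZagierPeriods.HyperbolicBloch.ZagierDilogarithmCyclotomic

/-- **Stub `stub_allRootsOfUnity_iff_milnor` (c5): the torsion cyclotomic sector of Zagier's conjecture
(all roots of unity, any orders) is EXACTLY the conjunction of Milnor's conjectures for all `N` —
unconditionally.** Every `ℤ`-relation `Σᵢ nᵢ D(uᵢ) = 0` among roots of unity `uᵢ` of the open upper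
half plane (each of some order `Nᵢ ≥ 1`) is explained up to torsion by Zagier's relators
(`M • Σᵢ nᵢ [uᵢ] ∈ ⟨dilogRelators⟩` for some `M ≥ 1`) if and only if, for every level `N ≥ 1`, the
primitive Clausen values `D(ζ_N^c)`, `c ∈ (ℤ/N)ˣ`, `0 < c < N/2`, are `ℤ`-linearly independent
(Milnor's conjecture at level `N`). Composition of the unconditional spanning
(`stub_cyclotomicSpanning`), folding (`stub_cyclotomicFolding`), the level-wise equivalence
(`stub_cyclotomicSectorTorsion_iff`) and the assembly of all levels (`stub_allRootsOfUnity_iff`).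
[cite: Milnor1982, Appendix] -/
theorem stub_allRootsOfUnity_iff_milnor :
    (∀ (k : ℕ) (u : Fin k → ℂ) (n : Fin k → ℤ), (∀ i, ∃ N : ℕ, 0 < N ∧ u i ^ N = 1) →
        (∀ i, 0 < (u i).im) → ∑ i, (n i : ℝ) * blochWignerDilog (u i) = 0 →
          ∃ M : ℕ, 0 < M ∧ M • (∑ i, n i • FreeAbelianGroup.of (u i)) ∈ AddSubgroup.closure dilogRelators) ↔
      ∀ (N : ℕ) [NeZero N] (m : ZMod N → ℤ), (∀ c, m c ≠ 0 → IsUnit c ∧ 0 < c.val ∧ 2 * c.val < N) →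
        ∑ c : ZMod N, (m c : ℝ) *
            blochWignerDilog (Complex.exp (2 * Real.pi * Complex.I / N) ^ c.val) = 0 →
          ∀ c, m c = 0 :=
  stub_allRootsOfUnity_iff fun N _ =>
    stub_cyclotomicSectorTorsion_iff (stub_cyclotomicFolding stub_cyclotomicSpanning) N

end Summit.KontsevichZagierPeriods.HyperbolicBloch.ZagierDilogarithmCyclotomic

end
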